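import Literature.AlgebraicGeometry.Motives.AbelianVarietyOrthogonalQuasiIdempotents
import Literature.AlgebraicGeometry.Motives.BaseChangeAlongInverse
import Mathlib.RingTheory.Localization.Basic
import HarnessLib

/-!
# A commutative subalgebra `R ⊆ End⁰(X)` containing `u` acts RATIONALLY on the image of `u`: `R → End⁰(Im u)`

D. Mumford, *Abelian Varieties* (1970), §19: `End⁰(X) = End(X) ⊗ ℚ` (Thm. 3 p. 176, Cor. 1–2 p. 178), images of endomorphisms
are abelian subvarieties (Thm. 1, p. 173) and, in the proof of Cor. 2 (p. 174), endomorphisms commuting with an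
idempotent restrict to its image; H. Lange, Ch. Birkenhake, *Complex Abelian Varieties* §5.3 / Lange 2023 §2.4.3
(«`X^ε = Im(nε)`», «this definition does not depend on the choice of `n`»).  The tree has the INTEGRAL restriction
★ `AbelianVariety.imageRestrict` / `imageAction` (`Motives/AbelianVarietyImageRestrict`: endomorphisms of `X` commuting
with `u : X ⟶ X` act on `Im u`, as a ring homomorphism `R →+* End (image u)` for an integral action `R →+* End X`).
Arithmetic consumers carry RATIONAL structures `M → End⁰_k(X)` (complex multiplication «up to isogeny», [Shimura1998]
§5.1 `ι : F → End_Q(A)` with its order `𝔯 = ι⁻¹(End A)`; [SerreTate1968] §4 `R = F ∩ End_K(A)`), so this file provides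
the `ℚ ⊗` version, for a COMMUTATIVE `ℚ`-subalgebra `R ⊆ End⁰(X)` containing `1 ⊗ u`:

* `exists_ringHom_endAlgebra_image_of_comm` — there is a ring homomorphism `ρ : R →+* End⁰(Im u)` with
  `ρ(1 ⊗ F) = 1 ⊗ F|_{Im u}` for every `F ∈ End X` with `1 ⊗ F ∈ R` (`F|_{Im u} = imageRestrict u F F _`);
* `exists_ringHom_endAlgebra_image_of_comm_of_quasiIdempotent` — if moreover `u ≫ u = n • u` then `ρ(1 ⊗ u) = n`, hence
  `ρ x = 0` whenever `x · (1 ⊗ u) = 0` (the complementary factor acts trivially).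

Construction (no new definition; everything inside the proofs): the order `O = {F ∈ End X | 1 ⊗ F ∈ R}` is a
commutative subring of `End X` acting on `Im u` by ★ `imageAction`; `R` is the localisation of `O` at the non-zero
integers (`End⁰ = ℚ ⊗ End`, ★ `endAlgebra.exists_eq_algebraMap_mul_of`, ★ injectivity of `End → End⁰`), and
`IsLocalization.lift` extends the action into the commutative subalgebra of `End⁰(Im u)` generated by the image of `O`
(the pattern of ★ `ComplexMultiplication.exists_ringHom_endAlgebra`).  Theorems only; no definition, no named fact,
no instance, no `sorry`; any base field.

DICTIONARY LINE (cell `hodgecm-mathlib`, crux `HLiu418` = stmt-HodgeConjecture-24832, d6 card S2′ road (6-i) step (4),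
«commutative semisimple `R ⊆ End⁰_F(X)` of full degree ⇒ fields of full degree on the factors `Im u_j`»; (J1a) ★
`AbelianVarietyQuasiIdempotentImageDual` wrote «`i := ℚ ⊗ imageAction`» — this is that `i`).  The file moves no book
(HC_CM is proved only modulo the 7 printed citations until rung 0 closes).

## References
* [MumfordAV1970] D. Mumford, *Abelian Varieties* (1970), §19 Thm. 1 (p. 173), proof of Cor. 2 (p. 174), Thm. 3 (p. 176) and
  Cor. 1–2 (p. 176).
* [Shimura1998] G. Shimura, *Abelian Varieties with Complex Multiplication and Modular Functions* (1998), §5.1 (p. 35: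
  `ι : F → End_Q(A)`, the order `𝔯`), §7.1 (pp. 46–47: orders, `𝔞`-multiplications).
* [SerreTate1968] J.-P. Serre, J. Tate, *Good reduction of abelian varieties*, Ann. of Math. 88 (1968), §4 (the pair
  `(A, i)`, `R = F ∩ End_K(A)`).
-/

noncomputable section

open CategoryTheory

namespace Literature.AlgebraicGeometry.Motives

namespace AbelianVariety

universe u

variable {K : Type u} [Field K] {X : AbelianVariety K}

/-- **A commutative `ℚ`-subalgebra `R ⊆ End⁰(X)` containing `1 ⊗ u` acts on `Im u` rationally**: there is a ring
homomorphism `ρ : R → End⁰(Im u)` with `ρ(1 ⊗ F) = 1 ⊗ (F|_{Im u})` for every endomorphism `F` of `X` with `1 ⊗ F ∈ R`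
(`F` commutes with `u` because `R` is commutative and `End X → End⁰(X)` is injective).
[cite: MumfordAV1970, §19 Thm. 1 (p. 173), proof of Cor. 2 (p. 174) and Thm. 3 (p. 176) with Cor. 1–2 (p. 178)]
[cite: Shimura1998, §5.1 (p. 35)] [cite: SerreTate1968, §4 (`R = F ∩ End_K(A)`)] -/
theorem exists_ringHom_endAlgebra_image_of_comm (R : Subalgebra ℚ X.endAlgebra)
    (hcomm : ∀ x ∈ R, ∀ y ∈ R, x * y = y * x) (u : X ⟶ X) (hu : endAlgebra.of X u ∈ R) :
    ∃ ρ : R →+* (image u).endAlgebra,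
      ∀ (F : X ⟶ X) (hF : endAlgebra.of X F ∈ R) (hFu : F ≫ u = u ≫ F),
        ρ ⟨endAlgebra.of X F, hF⟩ = endAlgebra.of (image u) (imageRestrict u F F hFu) := by
  classical
  have hinj : Function.Injective (endAlgebra.of X) :=
    endAlgebra.of_injective_of_isIsogeny_zsmul_id (isIsogeny_zsmul_id_holds X)
  -- the order `O = {F ∈ End X | 1 ⊗ F ∈ R}`, a commutative subring of `End X`
  let O : Subring (End X) := R.toSubring.comap (endAlgebra.of X)
  have hO : ∀ F : End X, F ∈ O ↔ endAlgebra.of X F ∈ R := fun F => Iff.rfl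
  have hOcomm : ∀ a b : O, (a : End X) * b = b * a := fun a b =>
    hinj (by rw [map_mul, map_mul]; exact hcomm _ ((hO _).1 a.2) _ ((hO _).1 b.2))
  letI : CommRing O := { (inferInstance : Ring O) with mul_comm := fun a b => Subtype.ext (hOcomm a b) }
  letI : CommRing R := { (inferInstance : Ring R) with mul_comm := fun x y => Subtype.ext (hcomm x x.2 y y.2) }
  -- `O → R`, `F ↦ 1 ⊗ F`
  let ψ : O →+* R := ((endAlgebra.of X).comp O.subtype).codRestrict R fun F => (hO F.1).1 F.2
  have hψ : ∀ F : O, ((ψ F : R) : X.endAlgebra) = endAlgebra.of X F := fun F => rfl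
  letI : Algebra O R := ψ.toAlgebra
  have halg : ∀ F : O, algebraMap O R F = ψ F := fun F => rfl
  -- `R` is the localisation of `O` at the non-zero integers
  let S : Submonoid O := Algebra.algebraMapSubmonoid O (nonZeroDivisors ℤ)
  have hSmem : ∀ y : S, ∃ z : ℤ, z ≠ 0 ∧ (y : O) = algebraMap ℤ O z := fun y => by
    obtain ⟨z, hz, hzy⟩ := Submonoid.mem_map.1 y.2
    exact ⟨z, nonZeroDivisors.ne_zero hz, hzy.symm⟩
  haveI : IsLocalization S R := by
    refine ⟨fun y => ?_, fun z => ?_, fun {a b} hab => ?_⟩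
    · obtain ⟨z, hz, hy⟩ := hSmem y
      rw [hy, halg, eq_intCast, map_intCast, ← map_intCast (algebraMap ℚ R)]
      exact ((isUnit_iff_ne_zero.2 (Int.cast_ne_zero.2 hz)).map (algebraMap ℚ R))
    · obtain ⟨M, F, hM, hz⟩ := endAlgebra.exists_eq_algebraMap_mul_of (z : X.endAlgebra)
      have hMq : (M : ℚ) ≠ 0 := Nat.cast_ne_zero.2 hM
      have hzM : (z : X.endAlgebra) * algebraMap ℚ _ (M : ℚ) = endAlgebra.of X F := by
        rw [hz, mul_assoc, (Algebra.commutes (M : ℚ) _).symm, ← mul_assoc, ← map_mul, inv_mul_cancel₀ hMq,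
          map_one, one_mul]
      have hFR : endAlgebra.of X F ∈ R := by
        rw [← hzM]; exact R.mul_mem z.2 (R.algebraMap_mem _)
      have hMS : algebraMap ℤ O (M : ℤ) ∈ S :=
        Submonoid.mem_map.2 ⟨(M : ℤ), mem_nonZeroDivisors_of_ne_zero (Int.natCast_ne_zero.2 hM), rfl⟩
      refine ⟨(⟨F, (hO F).2 hFR⟩, ⟨algebraMap ℤ O (M : ℤ), hMS⟩), Subtype.ext ?_⟩
      change (z : X.endAlgebra) * ((ψ (algebraMap ℤ O (M : ℤ)) : R) : X.endAlgebra) =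
        ((ψ ⟨F, _⟩ : R) : X.endAlgebra)
      have hMO : ((algebraMap ℤ O (M : ℤ) : O) : End X) = (M : End X) := by simp
      rw [hψ, hψ, hMO, map_natCast, ← hzM, map_natCast]
    · have h1 : (a : End X) = b := hinj (by
        have := congrArg (fun r : R => (r : X.endAlgebra)) hab
        simpa only [halg, hψ] using this)
      exact ⟨1, by rw [Subtype.ext h1]⟩
  -- the integral action of `O` on `Im u` (★ `imageAction`), valued in a commutative subalgebra `P` of `End⁰(Im u)`
  have huO : u ∈ O := (hO u).2 hu
  have hc : ∀ r : O, (O.subtype r).asHom ≫ u = u ≫ (O.subtype r).asHom := fun r => by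
    change (r : End X) ≫ u = u ≫ (r : End X)
    rw [← End.mul_def, ← End.mul_def]
    exact (hOcomm ⟨u, huO⟩ r)
  let ω : O →+* (image u).endAlgebra := (endAlgebra.of (image u)).comp (imageAction u O.subtype O.subtype hc)
  have hωcomm : ∀ a ∈ Set.range ω, ∀ b ∈ Set.range ω, a * b = b * a := by
    rintro _ ⟨x, rfl⟩ _ ⟨y, rfl⟩
    rw [← map_mul, ← map_mul, mul_comm]
  set P : Subalgebra ℚ (image u).endAlgebra := Algebra.adjoin ℚ (Set.range ω) with hP
  letI : CommRing P := { (inferInstance : Ring P) with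
    mul_comm := fun a b => (Algebra.isMulCommutative_adjoin ℚ hωcomm).is_comm.comm a b }
  let g : O →+* P := ω.codRestrict P fun x => Algebra.subset_adjoin ⟨x, rfl⟩
  have hg : ∀ y : S, IsUnit (g y) := fun y => by
    obtain ⟨z, hz, hy⟩ := hSmem y
    rw [hy, eq_intCast, map_intCast, ← map_intCast (algebraMap ℚ P)]
    exact ((isUnit_iff_ne_zero.2 (Int.cast_ne_zero.2 hz)).map (algebraMap ℚ P))
  refine ⟨(P.val : P →ₐ[ℚ] (image u).endAlgebra).toRingHom.comp (IsLocalization.lift (M := S) hg),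
    fun F hF hFu => ?_⟩
  have hFO : F ∈ O := (hO F).2 hF
  have key : (⟨endAlgebra.of X F, hF⟩ : R) = algebraMap O R ⟨F, hFO⟩ := Subtype.ext (by rw [halg, hψ])
  rw [RingHom.comp_apply, key, IsLocalization.lift_eq hg]
  have hres : imageAction u O.subtype O.subtype hc ⟨F, hFO⟩ = imageRestrict u F F hFu :=
    imageRestrict_unique u F F hFu _ (imageAction_ι u O.subtype O.subtype hc ⟨F, hFO⟩)
  change ω ⟨F, hFO⟩ = _
  change endAlgebra.of (image u) (imageAction u O.subtype O.subtype hc ⟨F, hFO⟩) = _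
  rw [hres]

/-- **… and a quasi-idempotent `u` (`u ≫ u = n • u`) acts on `Im u` as `n`**: with `ρ` as above, `ρ(1 ⊗ u) = n`, and
consequently `ρ x = 0` for every `x ∈ R` with `x · (1 ⊗ u) = 0` (for `n ≠ 0`).
[cite: MumfordAV1970, §19 Thm. 1 (p. 173) and proof of Cor. 2 (p. 174)] [cite: Shimura1998, §7.1 (pp. 46–47)] -/
theorem exists_ringHom_endAlgebra_image_of_comm_of_quasiIdempotent (R : Subalgebra ℚ X.endAlgebra)
    (hcomm : ∀ x ∈ R, ∀ y ∈ R, x * y = y * x) {u : X ⟶ X} {n : ℕ} (hu : endAlgebra.of X u ∈ R)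
    (hn : n ≠ 0) (huu : u ≫ u = n • u) :
    ∃ ρ : R →+* (image u).endAlgebra,
      (∀ (F : X ⟶ X) (hF : endAlgebra.of X F ∈ R) (hFu : F ≫ u = u ≫ F),
        ρ ⟨endAlgebra.of X F, hF⟩ = endAlgebra.of (image u) (imageRestrict u F F hFu)) ∧
      ρ ⟨endAlgebra.of X u, hu⟩ = algebraMap ℚ _ (n : ℚ) ∧
      ∀ x : R, (x : X.endAlgebra) * endAlgebra.of X u = 0 → ρ x = 0 := by
  obtain ⟨ρ, hρ⟩ := exists_ringHom_endAlgebra_image_of_comm R hcomm u hu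
  -- `u|_{Im u} = n • 𝟙` (cancel the epimorphism `X ↠ Im u`)
  have hres : imageRestrict u u u rfl = n • 𝟙 (image u) := by
    haveI := epi_toImage u
    rw [← cancel_epi (toImage u), toImage_imageRestrict, comp_toImage_eq_nsmul_toImage huu,
      Preadditive.comp_nsmul, Category.comp_id]
  have hres' : (imageRestrict u u u rfl : End (image u)) = (n : End (image u)) := by
    rw [← Nat.smul_one_eq_cast]; exact hres
  have hρu : ρ ⟨endAlgebra.of X u, hu⟩ = algebraMap ℚ _ (n : ℚ) := by
    rw [hρ u hu rfl, hres', map_natCast, map_natCast]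
  refine ⟨ρ, hρ, hρu, fun x hx => ?_⟩
  have h0 : ρ (x * ⟨endAlgebra.of X u, hu⟩) = 0 := by
    have : x * ⟨endAlgebra.of X u, hu⟩ = 0 := Subtype.ext hx
    rw [this, map_zero]
  rw [map_mul, hρu] at h0
  have hnq : (n : ℚ) ≠ 0 := Nat.cast_ne_zero.2 hn
  have := congrArg (fun y => y * algebraMap ℚ (image u).endAlgebra ((n : ℚ)⁻¹)) h0
  simpa only [mul_assoc, ← map_mul, mul_inv_cancel₀ hnq, map_one, mul_one, zero_mul] using this

end AbelianVariety

end Literature.AlgebraicGeometry.Motives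

end
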